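import Summits.BirchSwinnertonDyer.BirchSwinnertonDyer.Theses.TwistFamilyManinDescent
import Summits.BirchSwinnertonDyer.BirchSwinnertonDyer.Theorems.TwistFamilyManinDescentRaynaudRegimeOfKummerFreeEngine
import HarnessLib

/-!
# Crux `EisensteinRaynaudRegimeManinUnit` (Ray57, stmt-BirchSwinnertonDyer-26325) — LINE 16 skeleton
# «kummer-free-split» (registered 0b52c6d872fc, planner bsd-idea-3 g6), RECONSTRUCTED by the lead hand
# leafhand-bsd-twistfamilymaninde-1 g0 (2026-08-30) because the registered file lived in an unmounted seat folder.

Composition (all glues are landed tree theorems):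
`Ray57 h₁ h₂ h₃ h₄ = G15 (G16 h₄ S16a S16b) K15b h₁ h₂ h₃ h₄`, i.e.
`eisensteinRaynaudRegimeManinUnit_of_kummerFreeEngine_of_unstarredStrongManinUnit S16b K15b` (p624854), with
* `stub_noLocalPTorsion`  = S16a `RaynaudRegimeClassNoLocalPTorsion` (stmt-27295) — CLOSED in the tree
  (`raynaudRegimeClassNoLocalPTorsion_proof`, p624109); discharged below, no `sorry`;
* `stub_kummerFreeEngine` = S16b `SupersingularKummerFreeStrongIsUnstarred` (stmt-27296) — OPEN (beyond print:
  twisted-Vatsal engine, steps S3*/S4 at additive level);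
* `stub_unstarredManinUnit` = K15b `SupersingularUnstarredStrongManinUnit` (stmt-27071) — OPEN (print-extension of
  Edixhoven's thesis Thm 4.3.2 + Lemma 4.6.4 + Prop 4.2.4 to (p,d) ∈ {(5,3),(7,4)}).
No summit is proved by this file; BSD is not proved; Manin's conjecture is not proved.
-/

set_option autoImplicit false
set_option linter.dupNamespace false

noncomputable section

namespace Summit.BirchSwinnertonDyer.BirchSwinnertonDyer.Cruxes.EisensteinRaynaudRegimeManinUnit

open Summit.BirchSwinnertonDyer.BirchSwinnertonDyer.Theses.TwistFamilyManinDescent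
open Summit.BirchSwinnertonDyer.BirchSwinnertonDyer.Theorems.TwistFamilyManinDescent

/-- STUB (OPEN, = route item K15b stmt-BirchSwinnertonDyer-27071): Ray57 on its UNSTARRED rows (5; v₅Δ_min = 4) and
(7; v₇Δ_min = 3): `p ∤ c` for the lattice-optimal curve. Print-extension of Edixhoven's thesis (1989) Thm 4.3.2 +
Lemma 4.6.4 + Prop 4.2.4 (= 1991 Prop 7) to `(p, d) ∈ {(5,3),(7,4)}`. [cite: EdixhovenManin1991, Prop. 7, Thm. 3] -/
theorem stub_unstarredManinUnit : SupersingularUnstarredStrongManinUnit := by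
  sorry

/-- STUB (CLOSED by name: route item S16a stmt-BirchSwinnertonDyer-27295, tree theorem
`raynaudRegimeClassNoLocalPTorsion_proof`, p624109): on the Raynaud rows no curve ℚ-isogenous to `W` has a
`ℚ_p`-rational point of order `p`. [cite: Mazur1977, Ch. III §5, Step 1, p. 158] -/
theorem stub_noLocalPTorsion : RaynaudRegimeClassNoLocalPTorsion :=
  raynaudRegimeClassNoLocalPTorsion_proof

/-- STUB (OPEN, = route item S16b stmt-BirchSwinnertonDyer-27296): K15a restricted to KUMMER-FREE classes — on the
Raynaud rows with `p² ∣ N`, `E[p]` reducible, `p*`-twist additive, no `ℚ_p`-rational `p`-torsion anywhere in the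
class, a lattice-optimal `W` is UNSTARRED (`v_pΔ_min < 6`). Twisted-Vatsal engine (S1 optimality torsor, S2 local
triviality, S3* unramifiedness, S4 Ihara/Shimura subgroup, S5″ Kummer-free contradiction) — beyond print at additive
level. [cite: Vatsal2005, §4] [cite: Stevens1989Invent, Thm. 2.4] -/
theorem stub_kummerFreeEngine : SupersingularKummerFreeStrongIsUnstarred := by
  sorry

/-- **The crux by name, modulo the stubs**: `EisensteinRaynaudRegimeManinUnit` from `stub_kummerFreeEngine` (S16b) and
`stub_unstarredManinUnit` (K15b) through the landed cone
`eisensteinRaynaudRegimeManinUnit_of_kummerFreeEngine_of_unstarredStrongManinUnit` (G16 fed with the proved S16a =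
`stub_noLocalPTorsion`, then G15); modularity is Ray57's own fourth antecedent, so no free fact enters.
[cite: EdixhovenManin1991, Thm. 3 and Prop. 7] -/
theorem EisensteinRaynaudRegimeManinUnit_of : EisensteinRaynaudRegimeManinUnit :=
  fun h₁ h₂ h₃ h₄ ↦ raynaudRegimeOfOrientation_proof
    (strongIsUnstarredOfKummerFree_proof h₄ stub_noLocalPTorsion stub_kummerFreeEngine)
    stub_unstarredManinUnit h₁ h₂ h₃ h₄

end Summit.BirchSwinnertonDyer.BirchSwinnertonDyer.Cruxes.EisensteinRaynaudRegimeManinUnit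

end
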